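import Literature.MathematicalPhysics.PowerSystems.DroopSyncExponentialStability
import Literature.MathematicalPhysics.PowerSystems.NonuniformKuramotoPhaseCohesiveness
import Literature.MathematicalPhysics.PowerSystems.AcyclicSynchronizationCondition
import HarnessLib

/-!
# Local exponential stability of the synchronization manifold of the (lossless, non-uniform)
# Kuramoto model in `Δ̄_G(γ)`, `γ < π/2` — Dörfler–Chertkov–Bullo 2013, SI Lemma 2 (2)

Topic `Literature/MathematicalPhysics/PowerSystems` (LADDER-GRIDFUSION rungs G1/G3, model rows
«first-order coupled oscillators / Kuramoto» and «inverter, frequency droop»; seat gridfusion-lit-2).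
Companion of `PhaseCohesiveEquilibriumUniqueness.lean` and `AcyclicSynchronizationCondition.lean`,
whose module docstrings record that the «locally exponentially stable» clause of DCB2013 SI
Lemma 2 (2) / SI Theorem 2 «is linearisation theory and is NOT typed», and of
`DroopSyncExponentialStability.lean`, which PROVES that clause for the droop-controlled inverter
network `D_i θ̇_i = P̃_i − Σ_j a_ij sin(θ_i − θ_j)` (SPDB2013 Theorem 2 (i), all-inverter networks)
through Lyapunov's indirect method (`Literature/Analysis/ODE/LyapunovIndirectMethod.lean`).  Here
that theorem is READ ON THE KURAMOTO MODEL, in the tree's vocabulary `NonuniformKuramoto`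
(`NonuniformKuramotoPhaseCohesiveness.lean`: `θ̇ᵢ = (ωᵢ − Σⱼ Pᵢⱼ sin(θᵢ − θⱼ + φᵢⱼ))/Dᵢ`) with zero
phase shifts: SPDB2013 Lemma 1 («the parametric quantities of the two models are related via
`Pᵢ* = Ωᵢ` and `EᵢEⱼ|Yᵢⱼ| = aᵢⱼ`», tree `DroopNetwork.toKuramoto`) is run BACKWARDS
(`NonuniformKuramoto.toDroopNetwork`: `E = 1`, `|Y| = P`).  Everything is PROVED (no named fact,
no `sorry`).

SOURCES (held, read on the page this session).
* F. Dörfler, M. Chertkov, F. Bullo, *Synchronization in complex oscillator networks and smart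
  grids*, PNAS 110 (2013), Supporting Information [DorflerChertkovBullo2013; arXiv:1208.0045].
  §2.1 (chunk p0013 L28–L41): «for the parameters `V₁ = ∅` and `D_i = 1` … it reduces to the
  celebrated Kuramoto model `θ̇_i = ω_i − Σ_j a_ij sin(θ_i − θ_j)`» (eq-SI: Kuramoto model), the
  coupled oscillator model with `V₁ = ∅` being `D_i θ̇_i = ω_i − Σ_j a_ij sin(θ_i − θ_j)`, `D_i > 0`
  (chunk p0013 L17–L26); §2 (chunk p0015 L1–L9): «the explicit synchronization frequency is given
  by `ω_sync ≜ Σ_i ω_i / Σ_i D_i` … By transforming to a rotating frame with frequency `ω_sync` …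
  we assume that `ω ∈ 𝟙ₙ^⊥` such that `ω_sync = 0`»; §3.1 (chunk p0016 L31–L59), **SI Lemma 2
  (Stable synchronization in `Δ_G(π/2)`)**: «Consider the Kuramoto model with a connected graph
  `G(V, E, A)`, and let `γ ∈ [0, π/2[`. … 2) Stability: If there exists an equilibrium point
  `θ* ∈ Δ̄_G(γ)`, then it belongs to a locally exponentially stable equilibrium manifold
  `[θ*] ∈ Δ̄_G(γ)`», proof: «The Jacobian `J(θ)` evaluated at an equilibrium point `θ* ∈ Δ̄_G(γ)`
  is negative semidefinite with rank `n − 1`. Its nullspace is `𝟙ₙ` and arises from the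
  rotational symmetry … Consequently, the equilibrium point `θ* ∈ Δ̄_G(γ)` is locally
  (transversally) exponentially stable. Moreover, the corresponding equilibrium manifold
  `[θ*] ∈ Δ̄_G(γ)` is locally exponentially stable.»; SI Lemma 1 (chunk p0016 L13–L23): for
  `γ ∈ [0, π/2[` local exponential stability of `[θ]` for the Kuramoto model ⇔ for the coupled
  oscillator model.
* J. W. Simpson-Porco, F. Dörfler, F. Bullo, *Synchronization and power sharing for droop-controlled
  inverters in islanded microgrids*, Automatica 49 (2013) [SimpsonporcoDorflerBullo2013;
  arXiv:1206.5033], §3 Lemma 1 and Theorem 2 (chunks p0007 L71–L77, p0008 L23–L38, p0009 L1–L12)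
  — typed in `DroopControlledInverters.lean` / `DroopSyncExponentialStability.lean`.

WHAT IS PROVED, for `K : NonuniformKuramoto n` with `Dᵢ > 0`, zero phase shifts `φ = 0`,
symmetric nonnegative weights `P` with a connected coupling graph, and a configuration `θ₀` that is
PHASE-LOCKED at the synchronization frequency (`K.field θ₀ i = ω_sync = Σ ω / Σ D` for every `i`;
for `ω ∈ 𝟙ₙ^⊥` this says `θ₀` is an equilibrium) with `|θ₀ i − θ₀ j| < π/2` across every line:
* `toDroopNetwork`, `toDroopNetwork_a`, `field_eq_auxField_add` (the Kuramoto field is the (Aux)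
  field of the associated droop network plus `ω_sync`), `isAuxEquilibrium_of_locked`;
* **`lockedSolution_locally_expStable`** — `∃ ρ, k, λ > 0` such that every solution `θ` of the
  Kuramoto model on `[0, T]` with `‖θ 0 − θ₀‖ < ρ` satisfies, for `t ∈ [0, T]`,
  `‖θ t − (θ₀ + c𝟙 + ω_sync t 𝟙)‖ ≤ k ‖θ 0 − (θ₀ + c𝟙)‖ e^{−λt}`, with the rotation
  `c = Σ_i D_i(θ_i(0) − θ₀,i)/Σ_i D_i` fixed by the conserved quantity — the synchronization manifold
  `[θ₀]` (rotating at `ω_sync`) is locally exponentially stable;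
* **`equilibriumManifold_locally_expStable`** — the printed setting `ω ∈ 𝟙ₙ^⊥`, `θ₀` an
  equilibrium (`K.field θ₀ = 0`): `‖θ t − (θ₀ + c𝟙)‖ ≤ k ‖θ 0 − (θ₀ + c𝟙)‖ e^{−λt}`, and the limit
  `θ₀ + c𝟙 ∈ [θ₀]` is again an equilibrium (`field_eq_zero_of_mem_manifold`) — SI Lemma 2 (2);
  with `D = 1` it is
  literally the statement for (eq-SI: Kuramoto model), for general `Dᵢ > 0` the first-order coupled
  oscillator model (`V₁ = ∅`).

* §4–§7 THE OTHER LOCKED SOLUTIONS: `pair_lockedSolution_unstable_of_cos_neg` (two oscillators,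
  obtuse lock), `lockedSolution_unstable_of_negativeCurvature` (certificate `(κ, κ₂, e)`), §6 the
  pair picture, and (§7, append 2026-08-27) **`lockedSolution_unstable_of_negativeDirection`** /
  `lockedSolution_unstable_of_rowSum_cos_neg` — ONE real direction `e` with
  `Σ_i e_i Σ_j P_ij cos(θᵘ_i − θᵘ_j)(e_i − e_j) < 0` (no certificate) makes the locked solution
  unstable (via `DroopNetwork.unstable_of_negativeDirection`).

* §8 (append 2026-08-27) THE STABLE CLAUSE OF MANIK–TIMME–WITTHAUT'S LEMMA 1 («Kuramoto system») IN
  CERTIFICATE FORM: **`lockedSolution_locally_expStable_of_posCurvature`** (`_of_margin`),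
  `equilibriumManifold_locally_expStable_of_posCurvature`: no sign / connectivity / arc hypothesis —
  it suffices that the REAL Hessian form `u ↦ Σ_i u_i Σ_j P_ij cos(θ₀,i − θ₀,j)(u_i − u_j)` is `≥ 0`
  with kernel the constants (a transversal strict local minimum of the potential; loop-flow locked
  states with an edge beyond `π/2` included), via `DroopNetwork.expStable_modRotation_of_posCurvature`;
  `lockedSolution_expStable_of_modRotation` isolates the rotating-frame bookkeeping of §2,
  `toDroopNetwork_linWeight` the weights. [ManikTimmeWitthaut2017, §2 Lemma 1]

NOT here: second-order oscillators (`V₁ ≠ ∅`, SI Lemma 1's conjugacy [cite: DorflerBullo2012,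
Thms 5.1, 5.3]); lossy lines `φ ≠ 0`; statement 3) (uniqueness) is
`PhaseCohesiveEquilibriumUniqueness.lean`.

THREE COLUMNS.  Mathematics about MODEL «first-order (non-uniform) Kuramoto oscillators, lossless»
= «inverter, frequency droop» read through SPDB2013 Lemma 1; `ρ, k, λ` existential; «stable» is the
source's word about the model's synchronization manifold, never about a grid.

## Mathlib / tree search

Tree: `NonuniformKuramoto`, `NonuniformKuramoto.field`, `DroopNetwork.toKuramoto`
(`NonuniformKuramotoPhaseCohesiveness.lean`); `DroopNetwork.{a, injection, shiftedInjection,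
avgFrequency, IsAuxEquilibrium, injection_add_const}` (`DroopControlledInverters.lean`);
`DroopNetwork.{auxField, auxField_add_const, expStable_modRotation}`
(`DroopSyncExponentialStability.lean`); `ClassicalModel.CouplingConnected`
(`PhaseCohesiveEquilibriumUniqueness.lean`).  Mathlib: `hasDerivWithinAt_pi`,
`HasDerivWithinAt.const_mul` (used).  No Kuramoto linearised-stability statement existed in the tree
(`lean search "Kuramoto"`, `"exponentially stable"`).

## References

* F. Dörfler, M. Chertkov, F. Bullo, PNAS 110 (2013) 2005–2010, SI §2.1, §3.1 Lemma 2
  (arXiv:1208.0045, chunks p0013, p0015, p0016). [DorflerChertkovBullo2013]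
* J. W. Simpson-Porco, F. Dörfler, F. Bullo, Automatica 49 (2013) 2603–2611, §3 Lemma 1, Theorem 2
  (arXiv:1206.5033). [SimpsonporcoDorflerBullo2013]
* H. K. Khalil, *Nonlinear Systems*, 3rd ed., Theorem 4.7. [Khalil2002]
* D. Manik, M. Timme, D. Witthaut, Chaos 27 (2017) 083123 = arXiv:1611.09825, §2 Lemma 1 (held
  arXiv text p0004 L46–L55: local minimum of the potential ⇔ transversally asymptotically stable,
  Kuramoto and power-grid model). [ManikTimmeWitthaut2017]
-/

noncomputable section

open Set Filter Topology
open scoped Matrix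

namespace Literature.MathematicalPhysics.PowerSystems

namespace NonuniformKuramoto

variable {n : ℕ} (K : NonuniformKuramoto n)

/-! ## §1 The Kuramoto model as a droop network (SPDB2013 Lemma 1 backwards) -/

/-- The droop-controlled inverter network carrying a lossless non-uniform Kuramoto model: time
constants `D_i`, nominal injections `P_i* = ω_i`, unit voltage amplitudes and `|Y_ij| = P_ij`, so that
`a_ij = E_iE_j|Y_ij| = P_ij`. [cite: SimpsonporcoDorflerBullo2013, §3 Lemma 1 («`Pᵢ* = Ωᵢ` and
`EᵢEⱼ|Yᵢⱼ| = aᵢⱼ`»)] -/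
def toDroopNetwork : DroopNetwork n where
  Dc := K.D
  Pstar := K.ω
  E := fun _ => 1
  Yabs := K.P

/-- The coupling weights of the associated droop network are the Kuramoto weights.
[cite: SimpsonporcoDorflerBullo2013, §3 Lemma 1] -/
theorem toDroopNetwork_a : K.toDroopNetwork.a = K.P := by
  funext i j
  simp [DroopNetwork.a, toDroopNetwork]

/-- The injections of the associated droop network: `P_e,i(θ) = Σ_j P_ij sin(θ_i − θ_j)`.
[cite: SimpsonporcoDorflerBullo2013, §3 eq. (KuraDroop) and Lemma 1] -/
theorem toDroopNetwork_injection (θ : Fin n → ℝ) (i : Fin n) :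
    K.toDroopNetwork.injection θ i = ∑ j, K.P i j * Real.sin (θ i - θ j) := by
  simp [DroopNetwork.injection, toDroopNetwork_a]

/-- The synchronization frequency of the associated droop network is `ω_sync = Σ_i ω_i / Σ_i D_i`.
[cite: DorflerChertkovBullo2013, SI §2 («`ω_sync ≜ Σ ω_i / Σ D_i`»)] -/
theorem toDroopNetwork_avgFrequency :
    K.toDroopNetwork.avgFrequency = (∑ i, K.ω i) / ∑ i, K.D i := rfl

/-- **Rotating frame**: with zero phase shifts the Kuramoto field is the (Aux) field of the
associated droop network (frame rotating at `ω_sync`) plus `ω_sync`: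
`(ω_i − Σ_j P_ij sin(θ_i − θ_j))/D_i = (ω_i − D_iω_sync − Σ_j …)/D_i + ω_sync`.
[cite: DorflerChertkovBullo2013, SI §2 («By transforming to a rotating frame with frequency
`ω_sync` and by replacing `ω_i` by `ω_i − D_i ω_sync`»)] -/
theorem field_eq_auxField_add (hφ : ∀ i j, K.φ i j = 0) (hD : ∀ i, K.D i ≠ 0) (θ : Fin n → ℝ)
    (i : Fin n) :
    K.field θ i = K.toDroopNetwork.auxField θ i + (∑ j, K.ω j) / ∑ j, K.D j := by
  have hDi : K.D i ≠ 0 := hD i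
  simp only [field, hφ, add_zero, DroopNetwork.auxField, DroopNetwork.shiftedInjection,
    toDroopNetwork_injection, toDroopNetwork_avgFrequency]
  show _ = (K.ω i - (∑ j, K.ω j) / (∑ j, K.D j) * K.D i - ∑ j, K.P i j * Real.sin (θ i - θ j)) / K.D i
    + (∑ j, K.ω j) / ∑ j, K.D j
  field_simp
  ring

/-- Rotational symmetry: the Kuramoto field is invariant under `θ ↦ θ + c𝟙` (function form; the
pointwise form is the tree's `NonuniformKuramoto.field_add_const` in
`FiniteEquilibriumSetIsolation.lean`, not imported here to keep the import cone small).
[cite: DorflerChertkovBullo2013, SI §3.1 proof of Lemma 2 («the rotational symmetry of the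
right-hand side of the Kuramoto model»)] -/
private theorem field_add_const_funext (θ : Fin n → ℝ) (c : ℝ) :
    K.field (fun j => θ j + c) = K.field θ := by
  funext i
  simp only [field, add_sub_add_right_eq_sub]

/-- A configuration phase-locked at `ω_sync` is an (Aux)-equilibrium of the associated droop
network. [cite: SimpsonporcoDorflerBullo2013, §3 proof of Theorem 2, eq. (Aux)] -/
theorem isAuxEquilibrium_of_locked (hφ : ∀ i j, K.φ i j = 0) (hD : ∀ i, K.D i ≠ 0)
    {θ₀ : Fin n → ℝ} (hθ₀ : ∀ i, K.field θ₀ i = (∑ j, K.ω j) / ∑ j, K.D j) :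
    K.toDroopNetwork.IsAuxEquilibrium θ₀ := by
  intro i
  have h := hθ₀ i
  rw [K.field_eq_auxField_add hφ hD] at h
  have h0 : K.toDroopNetwork.auxField θ₀ i = 0 := by linarith
  unfold DroopNetwork.auxField at h0
  rcases div_eq_zero_iff.1 h0 with h1 | h1
  · linarith
  · exact absurd h1 (hD i)

/-! ## §2 The synchronization manifold is locally exponentially stable -/

/-- **DCB2013 SI Lemma 2 (2) / SPDB2013 Theorem 2 (i) read on the Kuramoto model — the
synchronization manifold `[θ₀]` is locally exponentially stable.**  For `Dᵢ > 0`, `φ = 0`,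
symmetric nonnegative weights with a connected coupling graph, and `θ₀` phase-locked at
`ω_sync = Σ ω / Σ D` with `|θ₀ i − θ₀ j| < π/2` across every line: there are `ρ, k, λ > 0` such that
every solution `θ` of `θ̇ᵢ = (ωᵢ − Σⱼ Pᵢⱼ sin(θᵢ − θⱼ))/Dᵢ` on `[0, T]` with `‖θ 0 − θ₀‖ < ρ`
satisfies `‖θ t − (θ₀ + c𝟙 + ω_sync t 𝟙)‖ ≤ k‖θ 0 − (θ₀ + c𝟙)‖e^{−λt}` on `[0, T]`, where
`c = Σ_i D_i(θ_i(0) − θ₀,i)/Σ_i D_i`.  MODEL: first-order non-uniform Kuramoto oscillators, lossless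
(= droop-controlled inverters, SPDB2013 Lemma 1).
[cite: DorflerChertkovBullo2013, SI §3.1 Lemma 2 (2); SimpsonporcoDorflerBullo2013, §3 Theorem 2 (i) with Lemma 1] -/
theorem lockedSolution_locally_expStable (hD : ∀ i, 0 < K.D i) (hφ : ∀ i j, K.φ i j = 0)
    (hP : ∀ i j, K.P i j = K.P j i) (hP0 : ∀ i j, 0 ≤ K.P i j)
    (hconn : ClassicalModel.CouplingConnected K.P) {θ₀ : Fin n → ℝ}
    (hθ₀ : ∀ i, K.field θ₀ i = (∑ j, K.ω j) / ∑ j, K.D j)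
    (harc : ∀ i j, i ≠ j → 0 < K.P i j → |θ₀ i - θ₀ j| < Real.pi / 2) :
    ∃ ρ > 0, ∃ k > 0, ∃ lam > 0, ∀ (θ : ℝ → Fin n → ℝ) (T : ℝ),
      (∀ t ∈ Icc 0 T, HasDerivWithinAt θ (K.field (θ t)) (Icc 0 T) t) → ‖θ 0 - θ₀‖ < ρ →
      ∀ t ∈ Icc 0 T,
        ‖θ t - fun i => θ₀ i + K.D ⬝ᵥ (θ 0 - θ₀) / (∑ i, K.D i) + (∑ j, K.ω j) / (∑ j, K.D j) * t‖
          ≤ k * ‖θ 0 - fun i => θ₀ i + K.D ⬝ᵥ (θ 0 - θ₀) / ∑ i, K.D i‖ * Real.exp (-lam * t) := by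
  have hD0 : ∀ i, K.D i ≠ 0 := fun i => (hD i).ne'
  set N : DroopNetwork n := K.toDroopNetwork with hN
  have hNa : N.a = K.P := K.toDroopNetwork_a
  have hY : ∀ i j, N.Yabs i j = N.Yabs j i := fun i j => hP i j
  have ha : ∀ i j, 0 ≤ N.a i j := fun i j => by rw [hNa]; exact hP0 i j
  have hconn' : ClassicalModel.CouplingConnected N.a := by rw [hNa]; exact hconn
  have hD' : ∀ i, 0 < N.Dc i := fun i => hD i
  have hθs : N.IsAuxEquilibrium θ₀ := K.isAuxEquilibrium_of_locked hφ hD0 hθ₀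
  have harc' : ∀ i j, i ≠ j → 0 < N.a i j → |θ₀ i - θ₀ j| < Real.pi / 2 := fun i j hij hij' =>
    harc i j hij (by rw [hNa] at hij'; exact hij')
  obtain ⟨ρ, hρ, k, hk, lam, hlam, H⟩ :=
    DroopNetwork.expStable_modRotation (N := N) hY ha hconn' hD' hθs harc'
  refine ⟨ρ, hρ, k, hk, lam, hlam, fun θ T hθ h0 t ht => ?_⟩
  -- the solution in the frame rotating at `ω_sync`
  set ωs : ℝ := (∑ j, K.ω j) / ∑ j, K.D j with hωs
  set X : ℝ → Fin n → ℝ := fun s i => θ s i - ωs * s with hXdef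
  have hX : ∀ s ∈ Icc 0 T, HasDerivWithinAt X (N.auxField (X s)) (Icc 0 T) s := by
    intro s hs
    have hlin : HasDerivWithinAt (fun τ : ℝ => fun _ : Fin n => ωs * τ) (fun _ : Fin n => ωs)
        (Icc 0 T) s := by
      refine hasDerivWithinAt_pi.2 fun i => ?_
      simpa using ((hasDerivWithinAt_id s (Icc 0 T)).const_mul ωs)
    have h1 := (hθ s hs).sub hlin
    have hval : K.field (θ s) - (fun _ : Fin n => ωs) = N.auxField (X s) := by
      have hXs : X s = fun i => θ s i + (-(ωs * s)) := by
        funext i; simp [hXdef]; ring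
      rw [hXs, DroopNetwork.auxField_add_const]
      funext i
      simp only [Pi.sub_apply, K.field_eq_auxField_add hφ hD0, hN, hωs]
      ring
    have hfun : (θ - fun τ : ℝ => fun _ : Fin n => ωs * τ) = X := by
      funext τ i; simp [hXdef]
    rw [hval, hfun] at h1
    exact h1
  have hX0 : X 0 = θ 0 := by funext i; simp [hXdef]
  have key := H X T hX (by rw [hX0]; exact h0) t ht
  rw [hX0] at key
  have hshape : (X t - fun i => θ₀ i + N.Dc ⬝ᵥ (θ 0 - θ₀) / ∑ i, N.Dc i)
      = θ t - fun i => θ₀ i + K.D ⬝ᵥ (θ 0 - θ₀) / (∑ i, K.D i) + ωs * t := by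
    funext i; simp [hXdef, hN, toDroopNetwork]; ring
  rw [hshape] at key
  exact key

/-- **DCB2013 SI Lemma 2 (2), printed setting (`ω ∈ 𝟙ₙ^⊥`): the equilibrium manifold `[θ*]` is
locally exponentially stable.**  For `Dᵢ > 0` (`Dᵢ = 1`: the Kuramoto model (eq-SI)), `φ = 0`,
symmetric nonnegative weights with a connected coupling graph, `Σ ω = 0`, and an EQUILIBRIUM `θ₀`
(`K.field θ₀ = 0`) with `|θ₀ i − θ₀ j| < π/2` across every line (`θ₀ ∈ Δ̄_G(γ)`, `γ < π/2`): there
are `ρ, k, λ > 0` such that every solution on `[0, T]` with `‖θ 0 − θ₀‖ < ρ` satisfies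
`‖θ t − (θ₀ + c𝟙)‖ ≤ k‖θ 0 − (θ₀ + c𝟙)‖e^{−λt}`, `c = Σ D_i(θ_i(0) − θ₀,i)/Σ D_i`; the limit
`θ₀ + c𝟙 ∈ [θ₀]` is an equilibrium (`field_eq_zero_of_mem_manifold`).  MODEL: first-order
(non-uniform) Kuramoto oscillators, lossless.
[cite: DorflerChertkovBullo2013, SI §3.1 Lemma 2 (2)] -/
theorem equilibriumManifold_locally_expStable (hD : ∀ i, 0 < K.D i) (hφ : ∀ i j, K.φ i j = 0)
    (hP : ∀ i j, K.P i j = K.P j i) (hP0 : ∀ i j, 0 ≤ K.P i j)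
    (hconn : ClassicalModel.CouplingConnected K.P) (hω : ∑ j, K.ω j = 0) {θ₀ : Fin n → ℝ}
    (hθ₀ : K.field θ₀ = 0)
    (harc : ∀ i j, i ≠ j → 0 < K.P i j → |θ₀ i - θ₀ j| < Real.pi / 2) :
    ∃ ρ > 0, ∃ k > 0, ∃ lam > 0, ∀ (θ : ℝ → Fin n → ℝ) (T : ℝ),
      (∀ t ∈ Icc 0 T, HasDerivWithinAt θ (K.field (θ t)) (Icc 0 T) t) → ‖θ 0 - θ₀‖ < ρ →
      ∀ t ∈ Icc 0 T,
        ‖θ t - fun i => θ₀ i + K.D ⬝ᵥ (θ 0 - θ₀) / ∑ i, K.D i‖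
          ≤ k * ‖θ 0 - fun i => θ₀ i + K.D ⬝ᵥ (θ 0 - θ₀) / ∑ i, K.D i‖ * Real.exp (-lam * t) := by
  have hθ₀' : ∀ i, K.field θ₀ i = (∑ j, K.ω j) / ∑ j, K.D j := fun i => by
    rw [hθ₀, hω]; simp
  obtain ⟨ρ, hρ, k, hk, lam, hlam, H⟩ :=
    K.lockedSolution_locally_expStable hD hφ hP hP0 hconn hθ₀' harc
  refine ⟨ρ, hρ, k, hk, lam, hlam, fun θ T hθ h0 t ht => ?_⟩
  have key := H θ T hθ h0 t ht
  simpa [hω] using key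

/-- The limit configuration `θ₀ + c𝟙` of `equilibriumManifold_locally_expStable` is again an
equilibrium of the Kuramoto model (a point of the equilibrium manifold `[θ₀]`).
[cite: DorflerChertkovBullo2013, SI §2 (definition of `[θ]`) and §3.1 Lemma 2 (2)] -/
theorem field_eq_zero_of_mem_manifold {θ₀ : Fin n → ℝ} (hθ₀ : K.field θ₀ = 0) (c : ℝ) :
    K.field (fun i => θ₀ i + c) = 0 := by
  rw [field_add_const_funext, hθ₀]

/-! ## §3 SI Theorem 2 (G1) WITH «exponentially stable» — the exact synchronization condition on
acyclic graphs (append 2026-08-27)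

[cite: DorflerChertkovBullo2013, SI §3.2 Theorem 2 (G1) (arXiv:1208.0045, chunk p0019 L17)]:
> «(G1) Exact synchronization condition for acyclic graphs: Assume that `G(V, E, A)` is acyclic.
> There exists an exponentially stable equilibrium `θ* ∈ Δ̄_G(γ)` if and only if condition
> [`‖BᵀL†ω‖_∞ ≤ sin(γ)`] holds. Moreover, in this case we have that `Bᵀθ* = arcsin(BᵀL†ω) ∈ Δ̄_G(γ)`.»

`AcyclicSynchronizationCondition.lean` (`ClassicalModel.RadialNetwork.exists_equilibrium_iff_treeFlow_le`)
PROVED the «if and only if» for the EXISTENCE of an equilibrium in `Δ̄_G(γ)` on a rooted tree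
(parent pointers, tree flow `u`, `γ ∈ [0, π/2]`) and recorded the «exponentially stable» clause as not
typed.  For `γ < π/2` that clause is §2 (`equilibriumManifold_locally_expStable`, read on the Kuramoto
model (eq-SI) with weights `C` and natural frequencies `P`, `ofWeights C P`): a tree whose edges carry
positive weights is a connected coupling graph (`couplingConnected_of_tree`). -/

/-- **The Kuramoto model (eq-SI) of a weighted graph**: `θ̇_i = ω_i − Σ_j C_ij sin(θ_i − θ_j)` —
unit time constants, weights `C`, natural frequencies `ω`, no phase shifts.
[cite: DorflerChertkovBullo2013, SI §2.1 eq. (Kuramoto model) (chunk p0013 L35–L41)] -/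
def ofWeights (C : Fin n → Fin n → ℝ) (ω : Fin n → ℝ) : NonuniformKuramoto n where
  D := fun _ => 1
  ω := ω
  P := C
  φ := fun _ _ => 0

/-- The field of `ofWeights C ω` is `ω_i − Σ_j C_ij sin(θ_i − θ_j)`.
[cite: DorflerChertkovBullo2013, SI §2.1 eq. (Kuramoto model)] -/
theorem ofWeights_field (C : Fin n → Fin n → ℝ) (ω : Fin n → ℝ) (θ : Fin n → ℝ) (i : Fin n) :
    (ofWeights C ω).field θ i = ω i - ∑ j, C i j * Real.sin (θ i - θ j) := by
  simp [field, ofWeights]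

/-- The diagonal weight `C_ii` never enters the field (`sin(θ_i − θ_i) = 0`): the models with weights
`C` and with its off-diagonal part have the same field.
[cite: DorflerChertkovBullo2013, SI §2.1 («We assume that the graph `G` has no self-loops `{i,i}`,
that is, `a_ii = 0`»)] -/
theorem ofWeights_field_offDiag (C : Fin n → Fin n → ℝ) (ω : Fin n → ℝ) :
    (ofWeights (fun i j => if i = j then 0 else C i j) ω).field = (ofWeights C ω).field := by
  funext θ i
  rw [ofWeights_field, ofWeights_field]
  congr 1
  refine Finset.sum_congr rfl fun j _ => ?_
  by_cases h : i = j
  · subst h; simp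
  · simp [h]

/-- **A rooted tree with positively weighted edges is a connected coupling graph** (cut form): walking
up the parent pointers from a node on the other side of the cut than the root crosses the cut along a
tree edge. [cite: DorflerChertkovBullo2013, SI §3.2 Thm 2 (G1) («acyclic» with the standing
assumption «connected graph», SI §2.1)] -/
theorem couplingConnected_of_tree {root : Fin n} {parent : Fin n → Fin n} {depth : Fin n → ℕ}
    (hroot : depth root = 0) (hdepth : ∀ i, i ≠ root → depth i = depth (parent i) + 1)
    (C : Fin n → Fin n → ℝ) (hC : ∀ i j, C i j = C j i) (ha : ∀ i, i ≠ root → 0 < C i (parent i)) :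
    ClassicalModel.CouplingConnected C := by
  intro S hS hSc
  -- from a node whose side differs from the root's, climb towards the root until the side flips
  have key : ∀ d (k : Fin n), depth k = d → (k ∈ S ↔ root ∉ S) → ∃ i ∈ S, ∃ j ∈ Sᶜ, 0 < C i j := by
    intro d
    induction d with
    | zero =>
      intro k hk hmem
      by_cases hkr : k = root
      · subst hkr; exact absurd hmem (by tauto)
      · have := hdepth k hkr; omega
    | succ d ih =>
      intro k hk hmem
      have hkr : k ≠ root := by rintro rfl; omega
      by_cases hside : (parent k ∈ S ↔ k ∈ S)
      · exact ih (parent k) (by have := hdepth k hkr; omega) (hside.trans hmem)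
      · by_cases hkS : k ∈ S
        · have hp : parent k ∉ S := fun h => hside ⟨fun _ => hkS, fun _ => h⟩
          exact ⟨k, hkS, parent k, Finset.mem_compl.2 hp, ha k hkr⟩
        · have hp : parent k ∈ S := by
            by_contra h; exact hside ⟨fun h' => absurd h' h, fun h' => absurd h' hkS⟩
          exact ⟨parent k, hp, k, Finset.mem_compl.2 hkS, by rw [hC]; exact ha k hkr⟩
  by_cases hr : root ∈ S
  · obtain ⟨k, hk⟩ := hSc
    exact key (depth k) k rfl ⟨fun h => absurd h (Finset.mem_compl.1 hk), fun h => absurd hr h⟩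
  · obtain ⟨k, hk⟩ := hS
    exact key (depth k) k rfl ⟨fun _ => hr, fun _ => hk⟩

/-- On a rooted tree the coupling is supported on the tree edges, which carry positive weights, so
every off-diagonal weight is nonnegative. [cite: DorflerChertkovBullo2013, SI §3.2 Thm 2 (G1)] -/
theorem coupling_nonneg_of_tree {root : Fin n} {parent : Fin n → Fin n} (C : Fin n → Fin n → ℝ)
    (hC : ∀ i j, C i j = C j i)
    (htree : ∀ i j, i ≠ j → C i j ≠ 0 → (i ≠ root ∧ j = parent i) ∨ (j ≠ root ∧ i = parent j))
    (ha : ∀ i, i ≠ root → 0 < C i (parent i)) {i j : Fin n} (hij : i ≠ j) : 0 ≤ C i j := by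
  by_cases h : C i j = 0
  · exact h.ge
  · rcases htree i j hij h with ⟨hi, hj⟩ | ⟨hj, hi⟩
    · rw [hj]; exact (ha i hi).le
    · rw [hi, hC]; exact (ha j hj).le

/-- **DCB2013 SI Theorem 2 (G1) with its stability word, on a rooted tree**: for weights `C`
(symmetric, supported on the tree edges, positive there), injections `P` consistent with the tree
flow `u` (`P_i = u_i − Σ_{children j} u_j`, no `u` at the root) and `γ ∈ [0, π/2[`, THERE IS an
equilibrium `θ ∈ Δ̄_G(γ)` of the Kuramoto model `θ̇_i = P_i − Σ_j C_ij sin(θ_i − θ_j)` which is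
LOCALLY EXPONENTIALLY STABLE as a point of its equilibrium manifold `[θ]` — `∃ ρ, k, λ > 0`, every
solution `ϑ` on `[0, T]` with `‖ϑ 0 − θ‖ < ρ` obeys `‖ϑ t − (θ + c𝟙)‖ ≤ k‖ϑ 0 − (θ + c𝟙)‖e^{−λt}`,
`c = Σ_i (ϑ_i(0) − θ_i)/n` — IF AND ONLY IF `|u_i| ≤ C_{i, parent i} sin γ` at every non-root node
(`‖BᵀL†ω‖_∞ ≤ sin γ` edge by edge).  MODEL: first-order Kuramoto oscillators (eq-SI), lossless,
radial; `θ, ρ, k, λ` existential.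
[cite: DorflerChertkovBullo2013, SI §3.2 Theorem 2 (G1); SI §3.1 Lemma 2 (2)] -/
theorem exists_expStable_equilibrium_iff_treeFlow_le {root : Fin n} {parent : Fin n → Fin n}
    {depth : Fin n → ℕ} (hroot : depth root = 0)
    (hdepth : ∀ i, i ≠ root → depth i = depth (parent i) + 1)
    (C : Fin n → Fin n → ℝ) (hC : ∀ i j, C i j = C j i)
    (htree : ∀ i j, i ≠ j → C i j ≠ 0 → (i ≠ root ∧ j = parent i) ∨ (j ≠ root ∧ i = parent j))
    (ha : ∀ i, i ≠ root → 0 < C i (parent i)) (P u : Fin n → ℝ)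
    (hcons : ∀ i, P i = (if i ≠ root then u i else 0)
      - ∑ j ∈ Finset.univ.filter (fun j => j ≠ root ∧ parent j = i), u j)
    {γ : ℝ} (hγ0 : 0 ≤ γ) (hγ : γ < Real.pi / 2) :
    (∃ θ : Fin n → ℝ, (∀ i, ∑ j, C i j * Real.sin (θ i - θ j) = P i) ∧
        (∀ i j, i ≠ j → C i j ≠ 0 → |θ i - θ j| ≤ γ) ∧
        ∃ ρ > 0, ∃ k > 0, ∃ lam > 0, ∀ (ϑ : ℝ → Fin n → ℝ) (T : ℝ),
          (∀ t ∈ Icc 0 T, HasDerivWithinAt ϑ ((ofWeights C P).field (ϑ t)) (Icc 0 T) t) →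
          ‖ϑ 0 - θ‖ < ρ → ∀ t ∈ Icc 0 T,
            ‖ϑ t - fun i => θ i + (∑ j, (ϑ 0 j - θ j)) / n‖
              ≤ k * ‖ϑ 0 - fun i => θ i + (∑ j, (ϑ 0 j - θ j)) / n‖ * Real.exp (-lam * t))
      ↔ ∀ i, i ≠ root → |u i| ≤ C i (parent i) * Real.sin γ := by
  have hiff := ClassicalModel.RadialNetwork.exists_equilibrium_iff_treeFlow_le hroot hdepth C hC
    htree ha P u hcons hγ0 hγ.le
  constructor
  · rintro ⟨θ, heq, hcoh, -⟩
    exact hiff.1 ⟨θ, heq, hcoh⟩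
  · intro hu
    obtain ⟨θ, heq, hcoh⟩ := hiff.2 hu
    refine ⟨θ, heq, hcoh, ?_⟩
    -- the Kuramoto model with the off-diagonal weights: same field, hypotheses of §2 available
    set C' : Fin n → Fin n → ℝ := fun i j => if i = j then 0 else C i j with hC'def
    set K' : NonuniformKuramoto n := ofWeights C' P with hK'
    have hC'od : ∀ {i j : Fin n}, i ≠ j → C' i j = C i j := fun hij => by simp [hC'def, hij]
    have hC'sym : ∀ i j, K'.P i j = K'.P j i := by
      intro i j
      show C' i j = C' j i
      by_cases h : i = j
      · subst h; rfl
      · rw [hC'od h, hC'od (Ne.symm h), hC]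
    have hC'0 : ∀ i j, 0 ≤ K'.P i j := by
      intro i j
      show 0 ≤ C' i j
      by_cases h : i = j
      · subst h; simp [hC'def]
      · rw [hC'od h]; exact coupling_nonneg_of_tree C hC htree ha h
    have hconn' : ClassicalModel.CouplingConnected K'.P := by
      intro S hS hSc
      obtain ⟨i, hi, j, hj, hpos⟩ := couplingConnected_of_tree hroot hdepth C hC ha S hS hSc
      have hij : i ≠ j := by rintro rfl; exact (Finset.mem_compl.1 hj) hi
      exact ⟨i, hi, j, hj, by show 0 < C' i j; rw [hC'od hij]; exact hpos⟩
    have hfield : K'.field = (ofWeights C P).field := by rw [hK']; exact ofWeights_field_offDiag C P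
    have hθ₀ : K'.field θ = 0 := by
      rw [hfield]; funext i; rw [ofWeights_field, heq i]; simp
    -- `Σ P = 0`: the injections of a lossless network sum to zero
    have hω : ∑ j, K'.ω j = 0 := by
      have hsum := K'.toDroopNetwork.sum_injection_eq_zero hC'sym θ
      have hinj : ∀ i, K'.toDroopNetwork.injection θ i = K'.ω i := by
        intro i
        have h0 := congrFun hθ₀ i
        rw [K'.field_eq_auxField_add (fun _ _ => rfl) (fun _ => one_ne_zero)] at h0
        simp only [DroopNetwork.auxField, DroopNetwork.shiftedInjection, toDroopNetwork_avgFrequency,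
          Pi.zero_apply] at h0
        have hD1 : K'.toDroopNetwork.Dc i = 1 := rfl
        have hP1 : K'.toDroopNetwork.Pstar i = K'.ω i := rfl
        rw [hD1, hP1] at h0
        linarith
      simpa [hinj] using hsum
    have harc : ∀ i j, i ≠ j → 0 < K'.P i j → |θ i - θ j| < Real.pi / 2 := by
      intro i j hij hpos
      have hne : C i j ≠ 0 := by
        have : 0 < C i j := by have h := hpos; change 0 < C' i j at h; rwa [hC'od hij] at h
        exact this.ne'
      exact (hcoh i j hij hne).trans_lt hγ
    obtain ⟨ρ, hρ, k, hk, lam, hlam, H⟩ := K'.equilibriumManifold_locally_expStable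
      (fun _ => one_pos) (fun _ _ => rfl) hC'sym hC'0 hconn' hω hθ₀ harc
    refine ⟨ρ, hρ, k, hk, lam, hlam, fun ϑ T hϑ h0 t ht => ?_⟩
    have key := H ϑ T (fun s hs => by rw [hfield]; exact hϑ s hs) h0 t ht
    have hc : K'.D ⬝ᵥ (ϑ 0 - θ) / ∑ i, K'.D i = (∑ j, (ϑ 0 j - θ j)) / n := by
      simp [hK', ofWeights, dotProduct]
    rw [hc] at key
    exact key

/-! ## §4 Two oscillators: the phase-locked solution across an obtuse angle is UNSTABLE (the saddle
of DCB2013's two-oscillator picture) (append 2026-08-27)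

[cite: DorflerChertkovBullo2013, SI §2 (chunk p0015 L31–L36)]: «For two first-order oscillators
(eq-SI: Kuramoto model) the state space `𝕋²`, the set `Δ_G(π/2)`, as well as the synchronization
manifold `[θ*]` associated to an angle array `θ* = (θ₁*, θ₂*) ∈ 𝕋²` are illustrated in Figure …».
A coupled pair with `|ω₁/D₁ − ω₂/D₂|` below the locking threshold has two phase-locked solutions
modulo rotation, `sin(θ₀ − θ₁) = ν/κ` with `cos(θ₀ − θ₁) > 0` (in `Δ_G(π/2)`, locally exponentially
stable by §2) and with `cos(θ₀ − θ₁) < 0`; the latter is UNSTABLE — read here on the Kuramoto model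
from `DroopNetwork.pair_unstable_of_cos_neg` (`DroopSyncExponentialStability.lean` §9, Lyapunov's
indirect method, instability half). -/

/-- **Two Kuramoto oscillators (lossless, `Dᵢ > 0`, `P₀₁ = P₁₀ > 0`): a phase-locked solution with
`cos(θ₀ᵘ − θ₁ᵘ) < 0` is UNSTABLE.**  There is `ε > 0` such that for every `η > 0` some initial state
`x₁` with `‖x₁ − θᵘ‖ < η` admits no solution of the Kuramoto model on `[0, ∞)` staying `ε`-close to
the locked solution `t ↦ θᵘ + ω_sync t 𝟙` (`ω_sync = Σω/ΣD`): `‖θ(t) − (θᵘ + ω_sync t 𝟙)‖ > ε` at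
some `t ≥ 0`.  MODEL: first-order non-uniform Kuramoto pair, lossless; `ε` existential.
[cite: DorflerChertkovBullo2013, SI §2 (two oscillators: synchronization manifold and saddle); Chiang1995, §2 (type-1 equilibrium point)] -/
theorem pair_lockedSolution_unstable_of_cos_neg {K : NonuniformKuramoto 2} (hD : ∀ i, 0 < K.D i)
    (hφ : ∀ i j, K.φ i j = 0) (hP : ∀ i j, K.P i j = K.P j i) (hP01 : 0 < K.P 0 1)
    {θu : Fin 2 → ℝ} (hθu : ∀ i, K.field θu i = (∑ j, K.ω j) / ∑ j, K.D j)
    (hcos : Real.cos (θu 0 - θu 1) < 0) :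
    ∃ ε > 0, ∀ η > 0, ∃ x₁ : Fin 2 → ℝ, ‖x₁ - θu‖ < η ∧ ∀ θ : ℝ → Fin 2 → ℝ,
      (∀ T : ℝ, ∀ t ∈ Icc 0 T, HasDerivWithinAt θ (K.field (θ t)) (Icc 0 T) t) → θ 0 = x₁ →
      ∃ t : ℝ, 0 ≤ t ∧ ε < ‖θ t - fun i => θu i + (∑ j, K.ω j) / (∑ j, K.D j) * t‖ := by
  have hD0 : ∀ i, K.D i ≠ 0 := fun i => (hD i).ne'
  set N : DroopNetwork 2 := K.toDroopNetwork with hN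
  have hY : ∀ i j, N.Yabs i j = N.Yabs j i := fun i j => hP i j
  have ha : 0 < N.a 0 1 := by rw [show N.a = K.P from K.toDroopNetwork_a]; exact hP01
  have hD' : ∀ i, 0 < N.Dc i := fun i => hD i
  have hθs : N.IsAuxEquilibrium θu := K.isAuxEquilibrium_of_locked hφ hD0 hθu
  obtain ⟨ε, hε, H⟩ := DroopNetwork.pair_unstable_of_cos_neg hY hD' ha hθs hcos
  refine ⟨ε, hε, fun η hη => ?_⟩
  obtain ⟨x₁, hx₁, Hx⟩ := H η hη
  refine ⟨x₁, hx₁, fun θ hθ h0 => ?_⟩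
  -- the solution in the frame rotating at `ω_sync`
  set ωs : ℝ := (∑ j, K.ω j) / ∑ j, K.D j with hωs
  set X : ℝ → Fin 2 → ℝ := fun s i => θ s i - ωs * s with hXdef
  have hX : ∀ T : ℝ, ∀ s ∈ Icc 0 T, HasDerivWithinAt X (N.auxField (X s)) (Icc 0 T) s := by
    intro T s hs
    have hlin : HasDerivWithinAt (fun τ : ℝ => fun _ : Fin 2 => ωs * τ) (fun _ : Fin 2 => ωs)
        (Icc 0 T) s := by
      refine hasDerivWithinAt_pi.2 fun i => ?_
      simpa using ((hasDerivWithinAt_id s (Icc 0 T)).const_mul ωs)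
    have h1 := (hθ T s hs).sub hlin
    have hval : K.field (θ s) - (fun _ : Fin 2 => ωs) = N.auxField (X s) := by
      have hXs : X s = fun i => θ s i + (-(ωs * s)) := by
        funext i; simp [hXdef]; ring
      rw [hXs, DroopNetwork.auxField_add_const]
      funext i
      simp only [Pi.sub_apply, K.field_eq_auxField_add hφ hD0, hN, hωs]
      ring
    have hfun : (θ - fun τ : ℝ => fun _ : Fin 2 => ωs * τ) = X := by
      funext τ i; simp [hXdef]
    rw [hval, hfun] at h1
    exact h1
  have hX0 : X 0 = x₁ := by funext i; simp [hXdef, h0]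
  obtain ⟨t, ht, hfar⟩ := Hx X hX hX0
  refine ⟨t, ht, ?_⟩
  have hshape : X t - θu = θ t - fun i => θu i + ωs * t := by
    funext i; simp [hXdef]; ring
  rw [← hshape]
  exact hfar

/-! ## §5 Any number of oscillators: a phase-locked solution with a separated direction of negative
curvature is UNSTABLE (append 2026-08-27)

The general-`n` form of §4, read on the Kuramoto model from
`DroopNetwork.unstable_of_negativeCurvature_real` (`DroopSyncExponentialStability.lean` §8/§10): the
Jacobian `−D⁻¹L(θᵘ)` is self-adjoint for the `D`-inner product; a certificate `(κ, κ₂, e)` —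
`L(θᵘ)e = κ De`, `κ < 0`, real gap `κ₂ Σ D_iu_i² ≤ ⟨u, L(θᵘ)u⟩` on `(De)^⊥`, `κ₂ > κ` — exhibits the
dominant positive eigenvalue `−κ`. [cite: Chiang1995, §2 (type-k equilibrium point) with §6.2
eq. (6.4) (the gradient system); DorflerChertkovBullo2013, SI §3.1 Lemma 2 (1) (the Jacobian is
`−B diag(a_ij cos(θ_i − θ_j))Bᵀ`, a Laplacian with possibly negative weights outside `Δ̄_G(π/2)`)] -/

/-- **A phase-locked solution of the lossless Kuramoto model carrying a separated direction of
negative curvature is UNSTABLE** (`Dᵢ > 0`, `φ = 0`, symmetric weights; certificate `(κ, κ₂, e)` on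
the Laplacian `L(θᵘ)` of the associated network, real gap form).  There is `ε > 0` such that for
every `η > 0` some `x₁` with `‖x₁ − θᵘ‖ < η` admits no solution on `[0, ∞)` staying `ε`-close to the
locked solution `t ↦ θᵘ + ω_sync t 𝟙`.  MODEL: first-order non-uniform Kuramoto oscillators, lossless;
`ε` existential.
[cite: Chiang1995, §2 with §6.2 eq. (6.4); DorflerChertkovBullo2013, SI §3.1 Lemma 2 (1)] -/
theorem lockedSolution_unstable_of_negativeCurvature (hD : ∀ i, 0 < K.D i) (hφ : ∀ i j, K.φ i j = 0)
    (hP : ∀ i j, K.P i j = K.P j i) {θu : Fin n → ℝ}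
    (hθu : ∀ i, K.field θu i = (∑ j, K.ω j) / ∑ j, K.D j) {κ κ₂ : ℝ} (hκ : κ < 0) (hκ₂ : κ < κ₂)
    {e : Fin n → ℝ} (he0 : e ≠ 0)
    (he : ∀ i, (K.toDroopNetwork.lap θu *ᵥ e) i = κ * (K.D i * e i))
    (hgap : ∀ u : Fin n → ℝ, ∑ i, K.D i * e i * u i = 0 →
      κ₂ * ∑ i, K.D i * u i ^ 2 ≤ ∑ i, u i * ∑ j, K.toDroopNetwork.linWeight θu i j * (u i - u j)) :
    ∃ ε > 0, ∀ η > 0, ∃ x₁ : Fin n → ℝ, ‖x₁ - θu‖ < η ∧ ∀ θ : ℝ → Fin n → ℝ,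
      (∀ T : ℝ, ∀ t ∈ Icc 0 T, HasDerivWithinAt θ (K.field (θ t)) (Icc 0 T) t) → θ 0 = x₁ →
      ∃ t : ℝ, 0 ≤ t ∧ ε < ‖θ t - fun i => θu i + (∑ j, K.ω j) / (∑ j, K.D j) * t‖ := by
  have hD0 : ∀ i, K.D i ≠ 0 := fun i => (hD i).ne'
  set N : DroopNetwork n := K.toDroopNetwork with hN
  have hY : ∀ i j, N.Yabs i j = N.Yabs j i := fun i j => hP i j
  have hD' : ∀ i, 0 < N.Dc i := fun i => hD i
  have hθs : N.IsAuxEquilibrium θu := K.isAuxEquilibrium_of_locked hφ hD0 hθu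
  obtain ⟨ε, hε, H⟩ := DroopNetwork.unstable_of_negativeCurvature_real hY hD' hθs hκ hκ₂ he0
    (fun i => he i) (fun u hu => hgap u hu)
  refine ⟨ε, hε, fun η hη => ?_⟩
  obtain ⟨x₁, hx₁, Hx⟩ := H η hη
  refine ⟨x₁, hx₁, fun θ hθ h0 => ?_⟩
  -- the solution in the frame rotating at `ω_sync`
  set ωs : ℝ := (∑ j, K.ω j) / ∑ j, K.D j with hωs
  set X : ℝ → Fin n → ℝ := fun s i => θ s i - ωs * s with hXdef
  have hX : ∀ T : ℝ, ∀ s ∈ Icc 0 T, HasDerivWithinAt X (N.auxField (X s)) (Icc 0 T) s := by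
    intro T s hs
    have hlin : HasDerivWithinAt (fun τ : ℝ => fun _ : Fin n => ωs * τ) (fun _ : Fin n => ωs)
        (Icc 0 T) s := by
      refine hasDerivWithinAt_pi.2 fun i => ?_
      simpa using ((hasDerivWithinAt_id s (Icc 0 T)).const_mul ωs)
    have h1 := (hθ T s hs).sub hlin
    have hval : K.field (θ s) - (fun _ : Fin n => ωs) = N.auxField (X s) := by
      have hXs : X s = fun i => θ s i + (-(ωs * s)) := by
        funext i; simp [hXdef]; ring
      rw [hXs, DroopNetwork.auxField_add_const]
      funext i
      simp only [Pi.sub_apply, K.field_eq_auxField_add hφ hD0, hN, hωs]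
      ring
    have hfun : (θ - fun τ : ℝ => fun _ : Fin n => ωs * τ) = X := by
      funext τ i; simp [hXdef]
    rw [hval, hfun] at h1
    exact h1
  have hX0 : X 0 = x₁ := by funext i; simp [hXdef, h0]
  obtain ⟨t, ht, hfar⟩ := Hx X hX hX0
  refine ⟨t, ht, ?_⟩
  have hshape : X t - θu = θ t - fun i => θu i + ωs * t := by
    funext i; simp [hXdef]; ring
  rw [← hshape]
  exact hfar

/-! ## §6 Two oscillators: the phase-locked solution inside the arc is locally exponentially stable
(the complete pair picture with §4) (append 2026-08-27)

[cite: DorflerChertkovBullo2013, SI §2 (two oscillators, chunk p0015 L31–L36) and SI Lemma 2 (2)] -/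

/-- **Two Kuramoto oscillators (lossless, `Dᵢ > 0`, `P ≥ 0`, `P₀₁ = P₁₀ > 0`): the phase-locked
solution with `|θ₀* − θ₁*| < π/2` is locally exponentially stable modulo rotation** (conclusion as in
`lockedSolution_locally_expStable`; connectivity is automatic for a coupled pair).  MODEL: first-order
non-uniform Kuramoto pair, lossless.
[cite: DorflerChertkovBullo2013, SI §3.1 Lemma 2 (2) with SI §2 (two oscillators)] -/
theorem pair_lockedSolution_locally_expStable {K : NonuniformKuramoto 2} (hD : ∀ i, 0 < K.D i)
    (hφ : ∀ i j, K.φ i j = 0) (hP : ∀ i j, K.P i j = K.P j i) (hP0 : ∀ i j, 0 ≤ K.P i j)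
    (hP01 : 0 < K.P 0 1) {θ₀ : Fin 2 → ℝ} (hθ₀ : ∀ i, K.field θ₀ i = (∑ j, K.ω j) / ∑ j, K.D j)
    (harc : |θ₀ 0 - θ₀ 1| < Real.pi / 2) :
    ∃ ρ > 0, ∃ k > 0, ∃ lam > 0, ∀ (θ : ℝ → Fin 2 → ℝ) (T : ℝ),
      (∀ t ∈ Icc 0 T, HasDerivWithinAt θ (K.field (θ t)) (Icc 0 T) t) → ‖θ 0 - θ₀‖ < ρ →
      ∀ t ∈ Icc 0 T,
        ‖θ t - fun i => θ₀ i + K.D ⬝ᵥ (θ 0 - θ₀) / (∑ i, K.D i) + (∑ j, K.ω j) / (∑ j, K.D j) * t‖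
          ≤ k * ‖θ 0 - fun i => θ₀ i + K.D ⬝ᵥ (θ 0 - θ₀) / ∑ i, K.D i‖ * Real.exp (-lam * t) := by
  have hconnN : ClassicalModel.CouplingConnected K.toDroopNetwork.a :=
    DroopNetwork.couplingConnected_pair (N := K.toDroopNetwork) (fun i j => hP i j)
      (by rw [K.toDroopNetwork_a]; exact hP01)
  have hconn : ClassicalModel.CouplingConnected K.P := by rw [← K.toDroopNetwork_a]; exact hconnN
  refine K.lockedSolution_locally_expStable hD hφ hP hP0 hconn hθ₀ ?_
  intro i j hij _
  fin_cases i <;> fin_cases j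
  · exact absurd rfl hij
  · exact harc
  · rw [abs_sub_comm]; exact harc
  · exact absurd rfl hij

/-! ## §7 Any number of oscillators: ONE direction of negative curvature makes the phase-locked
solution UNSTABLE — no separation certificate (append 2026-08-27, g9)

§5 read on `DroopNetwork.unstable_of_negativeDirection` (DroopSyncExponentialStability §13: the
first-order Kelvin–Tait–Chetaev mechanism + the general instability half of Lyapunov's indirect
method): the certificate `(κ, κ₂, e)` of §5 is replaced by the sign of ONE finite sum.
[cite: Chiang1995, §2 (type-k equilibrium point) with §6.2 eq. (6.4) (the gradient system);
DorflerChertkovBullo2013, SI §3.1 Lemma 2 (1)] -/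

/-- **A phase-locked solution of the lossless Kuramoto model with a direction of negative curvature
is UNSTABLE** (`Dᵢ > 0`, `φ = 0`, symmetric weights `P`; a real `e` with
`Σ_i e_i Σ_j P_ij cos(θᵘ_i − θᵘ_j)(e_i − e_j) < 0`).  There is `ε > 0` such that for every `η > 0`
some `x₁` with `‖x₁ − θᵘ‖ < η` admits no solution on `[0, ∞)` staying `ε`-close to the locked solution
`t ↦ θᵘ + ω_sync t 𝟙`.  MODEL: first-order non-uniform Kuramoto oscillators, lossless; `ε` existential.
[cite: Chiang1995, §2 with §6.2 eq. (6.4); DorflerChertkovBullo2013, SI §3.1 Lemma 2 (1); Khalil2002, Theorem 4.7 (part 2)] -/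
theorem lockedSolution_unstable_of_negativeDirection (hD : ∀ i, 0 < K.D i) (hφ : ∀ i j, K.φ i j = 0)
    (hP : ∀ i j, K.P i j = K.P j i) {θu : Fin n → ℝ}
    (hθu : ∀ i, K.field θu i = (∑ j, K.ω j) / ∑ j, K.D j) {e : Fin n → ℝ}
    (hneg : ∑ i, e i * ∑ j, K.toDroopNetwork.linWeight θu i j * (e i - e j) < 0) :
    ∃ ε > 0, ∀ η > 0, ∃ x₁ : Fin n → ℝ, ‖x₁ - θu‖ < η ∧ ∀ θ : ℝ → Fin n → ℝ,
      (∀ T : ℝ, ∀ t ∈ Icc 0 T, HasDerivWithinAt θ (K.field (θ t)) (Icc 0 T) t) → θ 0 = x₁ →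
      ∃ t : ℝ, 0 ≤ t ∧ ε < ‖θ t - fun i => θu i + (∑ j, K.ω j) / (∑ j, K.D j) * t‖ := by
  have hD0 : ∀ i, K.D i ≠ 0 := fun i => (hD i).ne'
  set N : DroopNetwork n := K.toDroopNetwork with hN
  have hY : ∀ i j, N.Yabs i j = N.Yabs j i := fun i j => hP i j
  have hD' : ∀ i, 0 < N.Dc i := fun i => hD i
  have hθs : N.IsAuxEquilibrium θu := K.isAuxEquilibrium_of_locked hφ hD0 hθu
  obtain ⟨ε, hε, H⟩ := DroopNetwork.unstable_of_negativeDirection hY hD' hθs (e := e) hneg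
  refine ⟨ε, hε, fun η hη => ?_⟩
  obtain ⟨x₁, hx₁, Hx⟩ := H η hη
  refine ⟨x₁, hx₁, fun θ hθ h0 => ?_⟩
  -- the solution in the frame rotating at `ω_sync`
  set ωs : ℝ := (∑ j, K.ω j) / ∑ j, K.D j with hωs
  set X : ℝ → Fin n → ℝ := fun s i => θ s i - ωs * s with hXdef
  have hX : ∀ T : ℝ, ∀ s ∈ Icc 0 T, HasDerivWithinAt X (N.auxField (X s)) (Icc 0 T) s := by
    intro T s hs
    have hlin : HasDerivWithinAt (fun τ : ℝ => fun _ : Fin n => ωs * τ) (fun _ : Fin n => ωs)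
        (Icc 0 T) s := by
      refine hasDerivWithinAt_pi.2 fun i => ?_
      simpa using ((hasDerivWithinAt_id s (Icc 0 T)).const_mul ωs)
    have h1 := (hθ T s hs).sub hlin
    have hval : K.field (θ s) - (fun _ : Fin n => ωs) = N.auxField (X s) := by
      have hXs : X s = fun i => θ s i + (-(ωs * s)) := by
        funext i; simp [hXdef]; ring
      rw [hXs, DroopNetwork.auxField_add_const]
      funext i
      simp only [Pi.sub_apply, K.field_eq_auxField_add hφ hD0, hN, hωs]
      ring
    have hfun : (θ - fun τ : ℝ => fun _ : Fin n => ωs * τ) = X := by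
      funext τ i; simp [hXdef]
    rw [hval, hfun] at h1
    exact h1
  have hX0 : X 0 = x₁ := by funext i; simp [hXdef, h0]
  obtain ⟨t, ht, hfar⟩ := Hx X hX hX0
  refine ⟨t, ht, ?_⟩
  have hshape : X t - θu = θ t - fun i => θu i + ωs * t := by
    funext i; simp [hXdef]; ring
  rw [← hshape]
  exact hfar

/-- **Two or more oscillators: an oscillator whose net linearised coupling is negative**
(`Σ_{j ≠ i} P_ij cos(θᵘ_i − θᵘ_j) < 0`) makes the phase-locked solution unstable (`e = 1_i`).
[cite: Chiang1995, §2 with §6.2 eq. (6.4); DorflerChertkovBullo2013, SI §3.1 Lemma 2 (1)] -/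
theorem lockedSolution_unstable_of_rowSum_cos_neg (hD : ∀ i, 0 < K.D i) (hφ : ∀ i j, K.φ i j = 0)
    (hP : ∀ i j, K.P i j = K.P j i) {θu : Fin n → ℝ}
    (hθu : ∀ i, K.field θu i = (∑ j, K.ω j) / ∑ j, K.D j) {i : Fin n}
    (hi : ∑ j ∈ Finset.univ.erase i, K.toDroopNetwork.linWeight θu i j < 0) :
    ∃ ε > 0, ∀ η > 0, ∃ x₁ : Fin n → ℝ, ‖x₁ - θu‖ < η ∧ ∀ θ : ℝ → Fin n → ℝ,
      (∀ T : ℝ, ∀ t ∈ Icc 0 T, HasDerivWithinAt θ (K.field (θ t)) (Icc 0 T) t) → θ 0 = x₁ →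
      ∃ t : ℝ, 0 ≤ t ∧ ε < ‖θ t - fun i => θu i + (∑ j, K.ω j) / (∑ j, K.D j) * t‖ := by
  classical
  refine K.lockedSolution_unstable_of_negativeDirection hD hφ hP hθu (e := Pi.single i 1) ?_
  have hcollapse : ∑ k, (Pi.single i (1 : ℝ) : Fin n → ℝ) k
      * ∑ j, K.toDroopNetwork.linWeight θu k j
        * ((Pi.single i (1 : ℝ) : Fin n → ℝ) k - (Pi.single i (1 : ℝ) : Fin n → ℝ) j)
      = ∑ j, K.toDroopNetwork.linWeight θu i j * (1 - (Pi.single i (1 : ℝ) : Fin n → ℝ) j) := by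
    rw [Fintype.sum_eq_single i (fun k hk => by simp [Pi.single_eq_of_ne hk])]
    simp
  have herase : ∑ j, K.toDroopNetwork.linWeight θu i j * (1 - (Pi.single i (1 : ℝ) : Fin n → ℝ) j)
      = ∑ j ∈ Finset.univ.erase i, K.toDroopNetwork.linWeight θu i j := by
    rw [← Finset.add_sum_erase Finset.univ _ (Finset.mem_univ i)]
    simp only [Pi.single_eq_same, sub_self, mul_zero, zero_add]
    refine Finset.sum_congr rfl fun j hj => ?_
    rw [Pi.single_eq_of_ne (Finset.ne_of_mem_erase hj), sub_zero, mul_one]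
  rw [hcollapse, herase]
  exact hi

/-! ## §8 A transversal strict local minimum of the potential is locally exponentially stable —
the stable clause of Manik–Timme–Witthaut's Lemma 1 («Kuramoto system») in certificate form, locked
solutions OUTSIDE the arc included (append 2026-08-27, g9)

§2 derives `L(θ₀) ⪰ 0` with kernel `span 𝟙` from the ARC condition (`P ≥ 0`, connected,
`|θ₀ i − θ₀ j| < π/2`).  The spectral argument needs only the conclusion on the REAL form
`u ↦ Σ_i u_i Σ_j P_ij cos(θ₀,i − θ₀,j)(u_i − u_j)`: `≥ 0` with equality only for constant `u` —
«μ_k > 0 for all k ∈ {2,…,N}» — which an exact PSD + rank certificate delivers also for loop-flow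
locked states with an edge beyond `π/2` (the multistable states of the source); §7 is the converse
direction.  Read on `DroopNetwork.expStable_modRotation_of_posCurvature`
(DroopSyncExponentialStability §14) through the rotating frame of §2.
[cite: ManikTimmeWitthaut2017, §2 Lemma 1 (arXiv:1611.09825 p0004 L46–L55: «a fixed point … is a
local minimum of the potential … if and only if it is transversally asymptotically stable for both
Kuramoto system and the power grid model system»); DorflerChertkovBullo2013, SI §3.1 Lemma 2 (2)] -/

/-- **Rotating frame ↔ Kuramoto solutions** — the bookkeeping of §2 with the (Aux)-estimate modulo
rotation taken as a hypothesis `H` (`Dᵢ > 0`, `φ = 0`): if every solution `X` of the associated droop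
network's (Aux) dynamics on `[0, T]` with `‖X 0 − θ₀‖ < ρ` obeys
`‖X t − (θ₀ + c𝟙)‖ ≤ k‖X 0 − (θ₀ + c𝟙)‖e^{−λt}`, then every Kuramoto solution `θ` on `[0, T]` with
`‖θ 0 − θ₀‖ < ρ` obeys `‖θ t − (θ₀ + c𝟙 + ω_sync t 𝟙)‖ ≤ k‖θ 0 − (θ₀ + c𝟙)‖e^{−λt}`,
`c = Σ D_i(θ_i(0) − θ₀,i)/Σ D_i`, `ω_sync = Σ ω/Σ D`.
[cite: SimpsonporcoDorflerBullo2013, §3 Lemma 1 with proof of Theorem 2 (rotating frame);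
DorflerChertkovBullo2013, SI §3.1 Lemma 2 (2)] -/
theorem lockedSolution_expStable_of_modRotation (hD : ∀ i, 0 < K.D i) (hφ : ∀ i j, K.φ i j = 0)
    {θ₀ : Fin n → ℝ} {ρ k lam : ℝ}
    (H : ∀ (X : ℝ → Fin n → ℝ) (T : ℝ),
      (∀ t ∈ Icc 0 T, HasDerivWithinAt X (K.toDroopNetwork.auxField (X t)) (Icc 0 T) t) →
      ‖X 0 - θ₀‖ < ρ →
      ∀ t ∈ Icc 0 T,
        ‖X t - fun i => θ₀ i + K.toDroopNetwork.Dc ⬝ᵥ (X 0 - θ₀) / ∑ i, K.toDroopNetwork.Dc i‖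
          ≤ k * ‖X 0 - fun i => θ₀ i + K.toDroopNetwork.Dc ⬝ᵥ (X 0 - θ₀) / ∑ i, K.toDroopNetwork.Dc i‖
            * Real.exp (-lam * t)) :
    ∀ (θ : ℝ → Fin n → ℝ) (T : ℝ),
      (∀ t ∈ Icc 0 T, HasDerivWithinAt θ (K.field (θ t)) (Icc 0 T) t) → ‖θ 0 - θ₀‖ < ρ →
      ∀ t ∈ Icc 0 T,
        ‖θ t - fun i => θ₀ i + K.D ⬝ᵥ (θ 0 - θ₀) / (∑ i, K.D i) + (∑ j, K.ω j) / (∑ j, K.D j) * t‖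
          ≤ k * ‖θ 0 - fun i => θ₀ i + K.D ⬝ᵥ (θ 0 - θ₀) / ∑ i, K.D i‖ * Real.exp (-lam * t) := by
  intro θ T hθ h0 t ht
  have hD0 : ∀ i, K.D i ≠ 0 := fun i => (hD i).ne'
  set N : DroopNetwork n := K.toDroopNetwork with hN
  -- the solution in the frame rotating at `ω_sync`
  set ωs : ℝ := (∑ j, K.ω j) / ∑ j, K.D j with hωs
  set X : ℝ → Fin n → ℝ := fun s i => θ s i - ωs * s with hXdef
  have hX : ∀ s ∈ Icc 0 T, HasDerivWithinAt X (N.auxField (X s)) (Icc 0 T) s := by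
    intro s hs
    have hlin : HasDerivWithinAt (fun τ : ℝ => fun _ : Fin n => ωs * τ) (fun _ : Fin n => ωs)
        (Icc 0 T) s := by
      refine hasDerivWithinAt_pi.2 fun i => ?_
      simpa using ((hasDerivWithinAt_id s (Icc 0 T)).const_mul ωs)
    have h1 := (hθ s hs).sub hlin
    have hval : K.field (θ s) - (fun _ : Fin n => ωs) = N.auxField (X s) := by
      have hXs : X s = fun i => θ s i + (-(ωs * s)) := by
        funext i; simp [hXdef]; ring
      rw [hXs, DroopNetwork.auxField_add_const]
      funext i
      simp only [Pi.sub_apply, K.field_eq_auxField_add hφ hD0, hN, hωs]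
      ring
    have hfun : (θ - fun τ : ℝ => fun _ : Fin n => ωs * τ) = X := by
      funext τ i; simp [hXdef]
    rw [hval, hfun] at h1
    exact h1
  have hX0 : X 0 = θ 0 := by funext i; simp [hXdef]
  have key := H X T hX (by rw [hX0]; exact h0) t ht
  rw [hX0] at key
  have hshape : (X t - fun i => θ₀ i + N.Dc ⬝ᵥ (θ 0 - θ₀) / ∑ i, N.Dc i)
      = θ t - fun i => θ₀ i + K.D ⬝ᵥ (θ 0 - θ₀) / (∑ i, K.D i) + ωs * t := by
    funext i; simp [hXdef, hN, toDroopNetwork]; ring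
  have hshape0 : (θ 0 - fun i => θ₀ i + N.Dc ⬝ᵥ (θ 0 - θ₀) / ∑ i, N.Dc i)
      = θ 0 - fun i => θ₀ i + K.D ⬝ᵥ (θ 0 - θ₀) / ∑ i, K.D i := by
    funext i; simp [hN, toDroopNetwork]
  rw [hshape, hshape0] at key
  exact key

/-- The linearised coupling weights of the associated droop network are `P_ij cos(θ_i − θ_j)`.
[cite: SimpsonporcoDorflerBullo2013, §3 Lemma 1; DorflerChertkovBullo2013, SI §3.1 proof of Lemma 2 («L(θ*)»)] -/
theorem toDroopNetwork_linWeight (θ : Fin n → ℝ) (i j : Fin n) :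
    K.toDroopNetwork.linWeight θ i j = K.P i j * Real.cos (θ i - θ j) := by
  simp [DroopNetwork.linWeight, toDroopNetwork_a]

/-- **MTW2017 Lemma 1, stable clause, for the lossless Kuramoto model — a phase-locked solution at a
transversal strict local minimum of the potential is locally exponentially stable (modulo the
rotation).**  `Dᵢ > 0`, `φ = 0`, symmetric weights `P` (NO sign condition, no connectivity or arc
hypothesis as such), `θ₀` phase-locked at `ω_sync = Σ ω/Σ D`, and the REAL Hessian form
`u ↦ Σ_i u_i Σ_j P_ij cos(θ₀,i − θ₀,j)(u_i − u_j)` is `≥ 0` with kernel the constants (e.g. the arc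
case — `DroopNetwork.posCurvature_of_arc` — or a loop-flow locked state with an edge beyond `π/2`
certified exactly).  Then there are `ρ, k, λ > 0` such that every solution `θ` on `[0, T]` with
`‖θ 0 − θ₀‖ < ρ` satisfies `‖θ t − (θ₀ + c𝟙 + ω_sync t 𝟙)‖ ≤ k‖θ 0 − (θ₀ + c𝟙)‖e^{−λt}` on
`[0, T]`, `c = Σ D_i(θ_i(0) − θ₀,i)/Σ D_i`.  MODEL: first-order non-uniform Kuramoto oscillators,
lossless; `ρ, k, λ` existential.
[cite: ManikTimmeWitthaut2017, §2 Lemma 1 (stable direction, «Kuramoto system»);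
DorflerChertkovBullo2013, SI §3.1 Lemma 2 (2)] -/
theorem lockedSolution_locally_expStable_of_posCurvature (hD : ∀ i, 0 < K.D i)
    (hφ : ∀ i j, K.φ i j = 0) (hP : ∀ i j, K.P i j = K.P j i) {θ₀ : Fin n → ℝ}
    (hθ₀ : ∀ i, K.field θ₀ i = (∑ j, K.ω j) / ∑ j, K.D j)
    (hpsd : ∀ u : Fin n → ℝ, 0 ≤ ∑ i, u i * ∑ j, K.P i j * Real.cos (θ₀ i - θ₀ j) * (u i - u j))
    (hker : ∀ u : Fin n → ℝ, ∑ i, u i * ∑ j, K.P i j * Real.cos (θ₀ i - θ₀ j) * (u i - u j) = 0 →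
      ∃ a : ℝ, u = fun _ => a) :
    ∃ ρ > 0, ∃ k > 0, ∃ lam > 0, ∀ (θ : ℝ → Fin n → ℝ) (T : ℝ),
      (∀ t ∈ Icc 0 T, HasDerivWithinAt θ (K.field (θ t)) (Icc 0 T) t) → ‖θ 0 - θ₀‖ < ρ →
      ∀ t ∈ Icc 0 T,
        ‖θ t - fun i => θ₀ i + K.D ⬝ᵥ (θ 0 - θ₀) / (∑ i, K.D i) + (∑ j, K.ω j) / (∑ j, K.D j) * t‖
          ≤ k * ‖θ 0 - fun i => θ₀ i + K.D ⬝ᵥ (θ 0 - θ₀) / ∑ i, K.D i‖ * Real.exp (-lam * t) := by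
  have hD0 : ∀ i, K.D i ≠ 0 := fun i => (hD i).ne'
  have hY : ∀ i j, K.toDroopNetwork.Yabs i j = K.toDroopNetwork.Yabs j i := fun i j => hP i j
  have hD' : ∀ i, 0 < K.toDroopNetwork.Dc i := fun i => hD i
  have hθs : K.toDroopNetwork.IsAuxEquilibrium θ₀ := K.isAuxEquilibrium_of_locked hφ hD0 hθ₀
  have hpsd' : ∀ u : Fin n → ℝ,
      0 ≤ ∑ i, u i * ∑ j, K.toDroopNetwork.linWeight θ₀ i j * (u i - u j) := fun u => by
    simpa only [toDroopNetwork_linWeight] using hpsd u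
  have hker' : ∀ u : Fin n → ℝ,
      ∑ i, u i * ∑ j, K.toDroopNetwork.linWeight θ₀ i j * (u i - u j) = 0 →
      ∃ a : ℝ, u = fun _ => a := fun u hu => by
    refine hker u ?_
    simpa only [toDroopNetwork_linWeight] using hu
  obtain ⟨ρ, hρ, k, hk, lam, hlam, H⟩ :=
    DroopNetwork.expStable_modRotation_of_posCurvature (N := K.toDroopNetwork) hY hD' hθs hpsd' hker'
  exact ⟨ρ, hρ, k, hk, lam, hlam, K.lockedSolution_expStable_of_modRotation hD hφ H⟩

/-- **MTW2017 Lemma 1, stable clause, printed setting `ω ∈ 𝟙ₙ^⊥`: an EQUILIBRIUM of the lossless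
Kuramoto model at a transversal strict local minimum of the potential belongs to a locally
exponentially stable equilibrium manifold `[θ₀]`.**  `Dᵢ > 0`, `φ = 0`, symmetric `P`, `Σ ω = 0`,
`K.field θ₀ = 0`, PSD + kernel certificate on the real Hessian form: `ρ, k, λ > 0` with
`‖θ t − (θ₀ + c𝟙)‖ ≤ k‖θ 0 − (θ₀ + c𝟙)‖e^{−λt}` for every solution on `[0, T]` with `‖θ 0 − θ₀‖ < ρ`
(the limit `θ₀ + c𝟙` is an equilibrium, `field_eq_zero_of_mem_manifold`).
[cite: ManikTimmeWitthaut2017, §2 Lemma 1 (stable direction, «Kuramoto system»);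
DorflerChertkovBullo2013, SI §3.1 Lemma 2 (2)] -/
theorem equilibriumManifold_locally_expStable_of_posCurvature (hD : ∀ i, 0 < K.D i)
    (hφ : ∀ i j, K.φ i j = 0) (hP : ∀ i j, K.P i j = K.P j i) (hω : ∑ j, K.ω j = 0)
    {θ₀ : Fin n → ℝ} (hθ₀ : K.field θ₀ = 0)
    (hpsd : ∀ u : Fin n → ℝ, 0 ≤ ∑ i, u i * ∑ j, K.P i j * Real.cos (θ₀ i - θ₀ j) * (u i - u j))
    (hker : ∀ u : Fin n → ℝ, ∑ i, u i * ∑ j, K.P i j * Real.cos (θ₀ i - θ₀ j) * (u i - u j) = 0 →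
      ∃ a : ℝ, u = fun _ => a) :
    ∃ ρ > 0, ∃ k > 0, ∃ lam > 0, ∀ (θ : ℝ → Fin n → ℝ) (T : ℝ),
      (∀ t ∈ Icc 0 T, HasDerivWithinAt θ (K.field (θ t)) (Icc 0 T) t) → ‖θ 0 - θ₀‖ < ρ →
      ∀ t ∈ Icc 0 T,
        ‖θ t - fun i => θ₀ i + K.D ⬝ᵥ (θ 0 - θ₀) / ∑ i, K.D i‖
          ≤ k * ‖θ 0 - fun i => θ₀ i + K.D ⬝ᵥ (θ 0 - θ₀) / ∑ i, K.D i‖ * Real.exp (-lam * t) := by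
  have hθ₀' : ∀ i, K.field θ₀ i = (∑ j, K.ω j) / ∑ j, K.D j := fun i => by
    rw [hθ₀, hω]; simp
  obtain ⟨ρ, hρ, k, hk, lam, hlam, H⟩ :=
    K.lockedSolution_locally_expStable_of_posCurvature hD hφ hP hθ₀' hpsd hker
  refine ⟨ρ, hρ, k, hk, lam, hlam, fun θ T hθ h0 t ht => ?_⟩
  have key := H θ T hθ h0 t ht
  simpa [hω] using key

/-- **A strict margin is a certificate** (the form users hand in): one node `i₀` and one `κ > 0`
with `κ Σ_i (u_i − u_{i₀})² ≤ Σ_i u_i Σ_j P_ij cos(θ₀,i − θ₀,j)(u_i − u_j)` for every real `u` give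
the PSD + kernel hypotheses, hence local exponential stability of the locked solution.
[cite: ManikTimmeWitthaut2017, §2 Lemma 1 (stable direction, «Kuramoto system»)] -/
theorem lockedSolution_locally_expStable_of_margin (hD : ∀ i, 0 < K.D i)
    (hφ : ∀ i j, K.φ i j = 0) (hP : ∀ i j, K.P i j = K.P j i) {θ₀ : Fin n → ℝ}
    (hθ₀ : ∀ i, K.field θ₀ i = (∑ j, K.ω j) / ∑ j, K.D j) {κ : ℝ} (hκ : 0 < κ) (i₀ : Fin n)
    (hmargin : ∀ u : Fin n → ℝ,
      κ * ∑ i, (u i - u i₀) ^ 2 ≤ ∑ i, u i * ∑ j, K.P i j * Real.cos (θ₀ i - θ₀ j) * (u i - u j)) :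
    ∃ ρ > 0, ∃ k > 0, ∃ lam > 0, ∀ (θ : ℝ → Fin n → ℝ) (T : ℝ),
      (∀ t ∈ Icc 0 T, HasDerivWithinAt θ (K.field (θ t)) (Icc 0 T) t) → ‖θ 0 - θ₀‖ < ρ →
      ∀ t ∈ Icc 0 T,
        ‖θ t - fun i => θ₀ i + K.D ⬝ᵥ (θ 0 - θ₀) / (∑ i, K.D i) + (∑ j, K.ω j) / (∑ j, K.D j) * t‖
          ≤ k * ‖θ 0 - fun i => θ₀ i + K.D ⬝ᵥ (θ 0 - θ₀) / ∑ i, K.D i‖ * Real.exp (-lam * t) := by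
  refine K.lockedSolution_locally_expStable_of_posCurvature hD hφ hP hθ₀
    (fun u => le_trans (mul_nonneg hκ.le (Finset.sum_nonneg fun i _ => sq_nonneg _)) (hmargin u))
    fun u hu => ⟨u i₀, funext fun i => ?_⟩
  have hs : κ * ∑ i, (u i - u i₀) ^ 2 ≤ 0 := hu ▸ hmargin u
  have hs0 : ∑ i, (u i - u i₀) ^ 2 ≤ 0 := by
    by_contra hcon
    push Not at hcon
    linarith [mul_pos hκ hcon]
  have hi := (Finset.sum_eq_zero_iff_of_nonneg fun i _ => sq_nonneg (u i - u i₀)).1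
    (le_antisymm hs0 (Finset.sum_nonneg fun i _ => sq_nonneg _)) i (Finset.mem_univ i)
  have : u i - u i₀ = 0 := by simpa using pow_eq_zero_iff (n := 2) (by norm_num) |>.1 hi
  linarith

end NonuniformKuramoto

end Literature.MathematicalPhysics.PowerSystems
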